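import Literature.MathematicalPhysics.QuantumFieldTheory.Balaban1983to89.B14Eq358TranslInv

/-!
# `Balaban1983to89.B14.Eq364Symmetries` — T. Bałaban, *Convergent renormalization expansions for lattice gauge theories*,
# Commun. Math. Phys. **119** (1988) 243–285 [Balaban1988Convergent], (3.64) p. 283 *"Thus the representation (I.5.16), or
# (I.5.37), implies β′_j = … = β_j. This is the required equality."* — with [I]'s second-order Taylor data (I.5.16)/(I.5.36)
# of the (3.63)-summed kernel NO LONGER A HYPOTHESIS: it is DERIVED, through [I] §5 ((5.6)–(5.10), (5.12)–(5.15) ⇒ (5.36)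
# with β = (5.42), the tree's `B12Transverse536.taylorData3_of_symmetries`), from the symmetries the summed kernel INHERITS
# from the three-point kernel: (3.48)-type decay, the covariances (3.59) under coordinate permutations and axis reflections,
# translation invariance (p. 281) and the first Ward identity (I.4.15)₁ in the `x`-slot

statement-level skeleton of published theorems with citation tags; proofs where landed; nothing here is a claim about the Yang–Mills mass gap

PDF held: `paper:balaban1988-cmp119-convergent-renormalization` (journal page = PDF page + 242); pp. 281–283 [PDF 39–41]
(quoted below from the renders read for `B14Eq364Beta` / `B14Eq358TranslInv`, same unit); [I] pp. 292–293, 297 [PDF 44–45,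
49] of `paper:balaban1987-cmp109-rg-i-small-field` as quoted in `B12Transverse536` / `B12Rep537` (cell pub-balaban, b03).

CITATION HEADER (lean-in-tree rule 2026-08-18).  WHAT IS REPRODUCED, verbatim.  [Balaban1988Convergent] p. 282 [PDF 40]:
*"β′_j = Π^{(j)}_{22,11}. (3.61) The last identity can be considered as a possible definition of the β-function. Now we prove
that it coincides with the definition (I.1.22). Using the translation invariance and the identity (I.4.15) again we have
β′_j = Σ_{x,y} Π^{(j)}_{22}(x, y, 0)x₁y₁ = … = −½ Σ_{x,z} Π^{(j)}_{22}(x, 0, z)x₁². (3.62) From the equality (2.26) for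
Λ_j = L^{−j}Z^d, and from the definitions (I.1.20), (I.5.1), we obtain Σ_z Π^{(j)}_{μν}(x, y, z) = Π^{(j)}_{μν}(x − y). (3.63)"*;
p. 283 [PDF 41]: *"Thus the representation (I.5.16), or (I.5.37), implies β′_j = −½ Σ_x Π^{(j)}_{22}(x)x₁² =
½((∂²/∂p₁²)Π̃^{(j)}_{22})(0) = β_j. (3.64) This is the required equality."*; p. 282, (3.59): *"((r⁻¹⊗r⁻¹)Π^{(j)}_{μν})(rx, ry,
rz) = Π^{(j)}_{μν}(x, y, z)"*; p. 281: *"This function is translation invariant"*.  [Balaban1987RG1] = [I], (1.22) p. 264: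
*"β_{j+1}(g_j) = −(∂²/∂p_μ∂p_ν Π̃_{j+1,μν})(g_j, 0) = Σ_x Π_{j+1,μν}(g_j, x)x_μx_ν for μ, ν arbitrary, μ ≠ ν"* (the tree's
`B12Beta.secondMoment`); §5 pp. 292–293: the properties (5.6) (permutations; p. 292), (5.7) (reflections), (5.9) (Ward identities),
(5.10) (exponential decay) of the kernel `Π_{μν}(x − y)`, and *"We will analyze this function using the above properties
only. Our goal is to prove a representation of the form (4.41), more exactly of the form Π_{μν}(p) = β(δ_{μν}Δ(p) −
\overline{∂_μ(p)}∂_ν(p)) + (terms of higher orders in derivatives ∂(p), \overline{∂(p)}), (5.16) and to find the coefficient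
β"*; (5.42) p. 297 *"the fundamental equality defining the β-function"*.

SKELETON rows (owner r11, `lit-balaban-r11/ROWS-B14.md`): **B14.Eq3.62–3.64** ((3.64) with the [I]-side input derived),
**B14.Eq3.58–3.61** ((3.59) as the source of [I]'s (5.6)/(5.7) for the summed kernel); cited [I] rows (owner r09/r20):
B12.Eq5.16, B12.Eq5.36-5.38 (`taylorData3_of_symmetries`), B12.Eq1.22 (`B12Beta.secondMoment`).

WHY A NEW FILE.  The chain of record proves (3.64) `β′_j = β` for the `β` of a HYPOTHESIS `hTD : ∀ μ ν, TaylorData3 β μ ν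
(sumKernel P3)_{μν}` = [I]'s representation (I.5.16)/(I.5.36) of the (3.63)-summed kernel (`B14.Eq364Beta.eq364`,
`Eq363SummedKernel.eq364_summed`, `Eq362Marginals.eq364_of_WT`, `Eq358TranslInv.eq364_kernelPt` — the last one with every
OTHER input discharged to (2.27)(i)–(iv) and (3.58)).  In [I] that representation is not an axiom but the OUTPUT of §5's
symmetry analysis, *"using the above properties only"*: permutation covariance (5.6)/(5.12), reflection covariance
(5.7)/(5.13), the first Ward identity (5.9)₁/(5.15), and the decay (5.10) — certified in the tree as
`B12Transverse536.taylorData3_of_symmetries` (with β = the second moment (5.42) = (1.22)).  For the (3.63)-summed kernel of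
[III] these four properties are CONSEQUENCES of what [III] prints about the three-point kernel `Π^{(j)}_{μν}(x, y, z)`: its
decay ((3.48) ⇒ `Decay3`), its covariance (3.59) under `r` = coordinate permutations and axis reflections TOGETHER WITH its
translation invariance (p. 281), and (I.4.15)₁ in the `x`-slot (p. 282 *"the identity (I.4.15) again"*).  THIS FILE proves
the four inheritances and assembles: (3.64) holds with `β_j := B12Beta.secondMoment (sumKernel P3) two one` — [I]'s
OWN (1.22)-definition of the β-function coefficient, evaluated on the kernel (3.63) — and with NO Taylor-data hypothesis.

WHAT IS PROVED (kernel-checked, sorry-free; theorems only; nothing existing is modified).  §1 over an abstract three-point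
kernel `P3 : Fin d → Fin d → Z^d → Z^d → Z^d → ℝ`:
* `axisSign_eq_rsgn`, `permPt_eq_comp`, `reflSrc_sub_reflSrc_zero` (`r_{α,μ}v − r_{α,ν}0 = R_{α;μν}v`, [I] (5.7)'s twisted
  reflection `B12Transverse536.reflTwist` on the difference variable IS [III]'s bond-source reflection (3.58) of the two bonds
  read in the difference variable) — the dictionary between the two papers' conventions;
* **`decay510_sumKernel`** — (3.48)-type `Decay3` ⇒ [I] (5.10) for every component of the summed kernel, rate `κ/2`
  (`Eq363SummedKernel.abs_sumKernel_le`);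
* **`permCovariant_sumKernel`** — (3.59) for the coordinate permutations (all `z`) ⇒ [I] (5.6)/(5.12) `B12Beta.PermCovariant`;
* **`reflCovariant_sumKernel`** — (3.59) for the axis reflections (all `z`) + translation invariance ⇒ [I] (5.7)/(5.13)
  `B12Transverse536.ReflCovariant` (the `y`-bond source `r_{α,ν}0 ≠ 0` is translated back to the origin — this is where
  *"This function is translation invariant"* enters a second time);
* **`wardFirst_sumKernel`** — (I.4.15)₁ in the `x`-slot, paired with the finitely supported gauge function `λ = δ_v`, for every
  `z`, summed over `z` (Fubini from `Decay3`) ⇒ [I] (5.9)₁/(5.15) `B12Transverse536.WardFirst`;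
* **`taylorData3_sumKernel`** — hence [I]'s (5.16)/(5.36) Taylor data with β = (5.42) FOR THE (3.63) KERNEL, by
  `B12Transverse536.taylorData3_of_symmetries`;
* **`eq364_of_symmetries`** — **(3.64)**: `betaPrime P3 one two = B12Beta.secondMoment (sumKernel P3) two one` for every
  translation invariant, decaying three-point kernel with the covariances (3.59) (all `z`) and the kernel Ward identities
  (I.4.15)₁ (`x`-slot for all `z`, `y`-slot at `z = 0`) — `Eq362Marginals.eq364_of_WT` with `hTD` DISCHARGED.
§2 for the whole-lattice kernel `kernelPt M g` of a `z`-pointed analytic localized family ((2.27), `B14.Eq358TranslInv`):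
* **`taylorData3_kernelPt`** and **`eq364_kernelPt_of_symmetries`** — (3.64) `β′_j = β_j` with hypotheses EXACTLY: the
  per-domain data (2.27)(i)(ii)(iv) (analyticity on the polydisc of radius `R`, the bound `E₀e^{−κd_j(X)}`, `κ` above the
  [II] (1.26) threshold), the linearized gauge invariance (2.27)(iii) `hginv`, and (3.58) for translations, axis reflections
  and coordinate permutations (`Eq358Transl`, `Eq358Refl`, `Eq358Perm`) — i.e. `Eq358TranslInv.eq364_kernelPt` WITHOUT `hTD`,
  `β` being [I]'s (1.22)-moment of the (3.63) kernel.  With `Eq358TranslInv.eq361_kernelPt` ((3.59) ⇒ (3.61)) this closes the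
  (3.57) → (3.61) → (3.64) kernel chain of [III] §3 on the inputs (2.27) + (3.58) alone.

MODEL NOTES (declared).  (M10) `β_j` := `B12Beta.secondMoment (sumKernel P3) two one` — [I]'s definition (1.22) (*"for μ, ν
arbitrary, μ ≠ ν"*; here `(μ, ν) = (two, one)`, `two ≠ one`) APPLIED to the kernel (3.63); that (3.63)'s right side IS [I]'s
vacuum-polarization kernel `Π^{(j)}_{μν}(x − y)` of (I.1.20)/(I.5.1) is print's identification *"from the definitions (I.1.20),
(I.5.1)"*, carried — as in `Eq363SummedKernel.eq364_summed` — by taking (3.63) as the definition of the two-point kernel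
(`B14.Eq364Beta` reading note (e)); the β-independence of the choice `(two, one)` is [I]'s `B12Beta` remark after (1.22) under
`PermCovariant` (not restated).  (M11) [I] §5 works in `d = 4` but `taylorData3_of_symmetries` is dimension-free (`B12Transverse536`
header); nothing here uses `d = 4`.  (M5)–(M9), (M1′)–(M4″) as in `B14.Eq358TranslInv` / `B14.Eq350KernelCauchy` /
`B14.Eq357KernelDecay`.

HONEST SCOPE — what is NOT claimed.  The middle member of (3.64) (the Fourier form `½(∂²/∂p₁²)Π̃_{22}(0)`) is
`B14.Eq364Beta.eq364_fourier` and is not re-derived; (I.5.37)/(I.5.38)'s third-order remainder STRUCTURE for the (3.63) kernel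
follows likewise from `B12Form543.form543_of_symmetries` but is not needed for (3.64) and not restated; no bound on, or sign
of, `β_j` is asserted (the β-function's size is [I] (5.45)–(5.47), rows B12.Eq5.45–5.47, not this file's business); the
per-domain data (2.27)(i)–(iv) and (3.58) remain hypotheses exactly as in `B14.Eq358TranslInv`.  No `def`, no new `Prop`,
no new named fact.  Mega-formalization `lit-balaban`, unit `lit-balaban-r11` gen 8 (B14 fold owner), HOME
`run/shared/lean/pub/lit-balaban/`.  Imports `B14Eq358TranslInv` only (which carries `B14Eq364Beta` ⊇ `B12Moments443` ⊇
`B12Form543` ⊇ `B12Transverse536`); modifies nothing there.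

## References
* [Balaban1988Convergent] T. Bałaban, Commun. Math. Phys. 119 (1988) 243–285: p. 281, (3.58)–(3.63) p. 282, (3.64) p. 283,
  (2.27) p. 259, (3.48) p. 280 (v1 wrote «p. 279»: the display is p. 280 [PDF 38] l.3, the «Consider the two cases» prose p. 279 —
  citeloc note of r12 gen 14; v1.2 CITELOC DOCFIX ONLY — docstrings / cite tags, every declaration byte-identical to v1.1
  p320892: [I] (5.6) is p. 292 [PDF 44] (v1–v1.1 wrote «p. 293» in `permPt_eq_comp`'s and `permCovariant_sumKernel`'s tags);
  (5.7)–(5.16) are p. 293 [PDF 45] — re-read on the text layer `paper:balaban1987-cmp109-rg-i-small-field`, journal page =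
  PDF page + 248).
* [Balaban1987RG1] T. Bałaban, Commun. Math. Phys. 109 (1987) 249–301 ([I]): (1.22) p. 264, (4.15) p. 284, (5.6)–(5.10),
  (5.12)–(5.16) pp. 292–293, (5.36)–(5.38), (5.42) p. 297.
-/

namespace Literature.MathematicalPhysics.QuantumFieldTheory.Balaban1983to89.B14.Eq364Symmetries

noncomputable section

open Literature.MathematicalPhysics.QuantumFieldTheory.GawedzkiKupiainen1985.PeriodicGleason (wt unitVec)
open Literature.MathematicalPhysics.QuantumFieldTheory.Balaban1983to89
open Literature.MathematicalPhysics.QuantumFieldTheory.Balaban1983to89.B13ScaleTransfer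
open Literature.MathematicalPhysics.QuantumFieldTheory.Balaban1983to89.TreeLength
open Literature.MathematicalPhysics.QuantumFieldTheory.Balaban1983to89.B12TreeDecay
open Literature.MathematicalPhysics.QuantumFieldTheory.Balaban1983to89.B14.Eq364Beta
open Literature.MathematicalPhysics.QuantumFieldTheory.Balaban1983to89.B14.Eq363SummedKernel
open Literature.MathematicalPhysics.QuantumFieldTheory.Balaban1983to89.B14.Eq357KernelDecay
open Literature.MathematicalPhysics.QuantumFieldTheory.Balaban1983to89.B14.Eq362KernelWard
open Literature.MathematicalPhysics.QuantumFieldTheory.Balaban1983to89.B14.Eq350KernelCauchy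
open Literature.MathematicalPhysics.QuantumFieldTheory.Balaban1983to89.B14.Eq362Marginals (grad)
open Literature.MathematicalPhysics.QuantumFieldTheory.Balaban1983to89.B14.Eq360TensorInvariance (reflSrc permPt permPtEquiv)
open Literature.MathematicalPhysics.QuantumFieldTheory.Balaban1983to89.B14.Eq358TranslInv
open Literature.MathematicalPhysics.QuantumFieldTheory.Balaban1983to89.B12Transverse536 (reflTwist tw rsgn ReflCovariant
  WardFirst taylorData3_of_symmetries)
open Literature.MathematicalPhysics.QuantumFieldTheory.Dimock2011to13.PolydiscCauchyBounds
open _root_.Filter _root_.Topology _root_.Metric Function Finset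

variable {d : ℕ}

/-! ## §1. The (3.63)-summed kernel inherits [I]'s four properties (5.6), (5.7), (5.9)₁, (5.10) -/

section Abstract

variable {P3 : Fin d → Fin d → Pt d → Pt d → Pt d → ℝ} {C κ : ℝ}

/-- Dictionary: [III]'s axis sign `s_α(i)` of (3.58) (`B14Sect3.axisSign`) IS [I]'s reflection sign `ε_i` of (5.7)
(`B12Transverse536.rsgn`). [cite: Balaban1988Convergent, (3.58) p.282; Balaban1987RG1, (5.7) p.293] -/
theorem axisSign_eq_rsgn (α i : Fin d) : B14Sect3.axisSign α i = rsgn α i := rfl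

/-- Dictionary: [III]'s coordinate permutation of points (`Eq360TensorInvariance.permPt`, `(σx)_i = x_{σ⁻¹i}`) IS [I]'s
`x ∘ σ⁻¹` of (1.21)/(5.6) (`B12Beta.PermCovariant`). [cite: Balaban1988Convergent, (3.59) p.282; Balaban1987RG1, (5.6) p.292] -/
theorem permPt_eq_comp (σ : Equiv.Perm (Fin d)) (x : Pt d) : permPt σ x = x ∘ σ.symm := rfl

/-- Dictionary: the bond-source reflections of (3.58) read in the difference variable ARE [I]'s twisted reflection (5.7):
`r_{α,μ}v − r_{α,ν}0 = R_{α;μν}v` (`(R_{α;μν}v)_α = −v_α − [μ=α] + [ν=α]`, other coordinates unchanged).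
[cite: Balaban1988Convergent, (3.58) p.282; Balaban1987RG1, (5.7) p.293] -/
theorem reflSrc_sub_reflSrc_zero (α μ ν : Fin d) (v : Pt d) :
    reflSrc α μ v - reflSrc α ν 0 = reflTwist α μ ν v := by
  funext i
  by_cases hi : i = α
  · subst hi
    simp only [Pi.sub_apply, reflSrc, if_true, Pi.zero_apply, neg_zero, zero_sub,
      B12Transverse536.reflTwist_self, tw]
    split_ifs <;> ring
  · simp only [Pi.sub_apply, reflSrc, hi, if_false, Pi.zero_apply, sub_zero]
    rw [reflTwist, Function.update_of_ne hi]

/-- **[I] (5.10) for the (3.63)-summed kernel**: `|Π_{μν}(v)| ≤ C·S·e^{−(κ/2)|v|₁}`, `S = Σ_z e^{−(κ/2)|z|₁}`, from the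
(3.48)-type product decay of the three-point kernel (`Eq363SummedKernel.abs_sumKernel_le`).
[cite: Balaban1988Convergent, (3.48) p.280, (3.63) p.282; Balaban1987RG1, (5.10) p.293] -/
theorem decay510_sumKernel (hD : Decay3 P3 C κ) (hκ : 0 < κ) (μ ν : Fin d) :
    B12Sec2to5.Decay510 (sumKernel P3 μ ν) (C * ∑' z : Pt d, wt (κ / 2) z) (κ / 2) :=
  fun v => abs_sumKernel_le hD hκ μ ν v

/-- **[I] (5.6)/(5.12) for the (3.63)-summed kernel** from (3.59) for the coordinate permutations at every `z`
(`Π_{μν}(x, y, z) = Π_{σμ,σν}(σx, σy, σz)`): `Π_{σμ,σν}(σv) = Π_{μν}(v)` (re-indexing the `z`-sum by `σ`, `σ0 = 0`).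
[cite: Balaban1988Convergent, (3.59) p.282; Balaban1987RG1, (5.6) p.292, (5.12) p.293] -/
theorem permCovariant_sumKernel
    (hP : ∀ (σ : Equiv.Perm (Fin d)) μ ν x y z, P3 μ ν x y z = P3 (σ μ) (σ ν) (permPt σ x) (permPt σ y) (permPt σ z)) :
    B12Beta.PermCovariant (sumKernel P3) := by
  intro σ μ ν v
  have hz : permPt σ (0 : Pt d) = 0 := by
    funext i
    simp [permPt]
  rw [sumKernel_apply, sumKernel_apply]
  have h1 : (fun z : Pt d => P3 μ ν v 0 z) = fun z => P3 (σ μ) (σ ν) (permPt σ v) 0 (permPtEquiv σ z) := by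
    funext z
    rw [hP σ μ ν v 0 z, hz]
    rfl
  rw [h1, Equiv.tsum_eq (permPtEquiv σ) (fun w => P3 (σ μ) (σ ν) (permPt σ v) 0 w)]
  rfl

/-- `r_α` is an involution of `Z^d`. [cite: Balaban1988Convergent, (3.58) p.282] -/
theorem reflPt_reflPt (α : Fin d) (z : Pt d) : reflPt α (reflPt α z) = z := by
  funext i
  simp only [reflPt]
  split_ifs <;> ring

/-- Re-indexing a lattice sum by `z ↦ r_αz − a` (an involution followed by a translation).
[cite: Balaban1988Convergent, (3.58) p.282] -/
theorem tsum_reflPt_sub (α : Fin d) (a : Pt d) (f : Pt d → ℝ) :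
    ∑' z, f (reflPt α z - a) = ∑' w, f w :=
  Equiv.tsum_eq ((Function.Involutive.toPerm (reflPt α) (reflPt_reflPt α)).trans (Equiv.subRight a)) f

/-- **[I] (5.7)/(5.13) for the (3.63)-summed kernel** from (3.59) for the axis reflections at every `z`
(`Π_{μν}(x, y, z) = s_α(μ)s_α(ν)Π_{μν}(r_{α,μ}x, r_{α,ν}y, r_αz)`) and translation invariance (p. 281):
`Π_{μν}(R_{α;μν}v) = ε_με_ν Π_{μν}(v)` — the reflected `y`-bond source `r_{α,ν}0` is translated back to the origin and the
`z`-sum re-indexed by `z ↦ r_αz − r_{α,ν}0`. [cite: Balaban1988Convergent, (3.59) p.282, p.281; Balaban1987RG1, (5.7)/(5.13) p.293] -/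
theorem reflCovariant_sumKernel (hT : TranslInv P3)
    (hR : ∀ α μ ν x y z, P3 μ ν x y z = B14Sect3.axisSign α μ * B14Sect3.axisSign α ν
      * P3 μ ν (reflSrc α μ x) (reflSrc α ν y) (reflPt α z)) :
    ReflCovariant (sumKernel P3) := by
  intro α μ ν v
  rw [sumKernel_apply, sumKernel_apply]
  have hs : ∀ i, B14Sect3.axisSign α i * B14Sect3.axisSign α i = 1 := by
    intro i
    unfold B14Sect3.axisSign
    split_ifs <;> norm_num
  -- each term: (3.59) then the translation by `−r_{α,ν}0` (p. 281 "This function is translation invariant")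
  have h1 : ∀ z, P3 μ ν v 0 z = B14Sect3.axisSign α μ * B14Sect3.axisSign α ν
      * P3 μ ν (reflTwist α μ ν v) 0 (reflPt α z - reflSrc α ν 0) := by
    intro z
    rw [hR α μ ν v 0 z]
    congr 1
    have h := hT μ ν (reflSrc α μ v - reflSrc α ν 0) 0 (reflPt α z - reflSrc α ν 0) (reflSrc α ν 0)
    rw [sub_add_cancel, zero_add, sub_add_cancel] at h
    rw [h, reflSrc_sub_reflSrc_zero]
  have h2 : (fun z => P3 μ ν v 0 z) = fun z => B14Sect3.axisSign α μ * B14Sect3.axisSign α ν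
      * P3 μ ν (reflTwist α μ ν v) 0 (reflPt α z - reflSrc α ν 0) := funext h1
  calc ∑' z, P3 μ ν (reflTwist α μ ν v) 0 z
      = ∑' z, P3 μ ν (reflTwist α μ ν v) 0 (reflPt α z - reflSrc α ν 0) :=
        (tsum_reflPt_sub α (reflSrc α ν 0) (fun w => P3 μ ν (reflTwist α μ ν v) 0 w)).symm
    _ = (B14Sect3.axisSign α μ * B14Sect3.axisSign α ν) * ((B14Sect3.axisSign α μ * B14Sect3.axisSign α ν)
          * ∑' z, P3 μ ν (reflTwist α μ ν v) 0 (reflPt α z - reflSrc α ν 0)) := by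
        rw [← mul_assoc, show B14Sect3.axisSign α μ * B14Sect3.axisSign α ν *
          (B14Sect3.axisSign α μ * B14Sect3.axisSign α ν) = (B14Sect3.axisSign α μ * B14Sect3.axisSign α μ) *
          (B14Sect3.axisSign α ν * B14Sect3.axisSign α ν) by ring, hs μ, hs ν, one_mul, one_mul]
    _ = rsgn α μ * rsgn α ν * ∑' z, P3 μ ν v 0 z := by
        rw [h2, tsum_mul_left, axisSign_eq_rsgn, axisSign_eq_rsgn]

/-- (I.4.15)₁ in the `x`-slot paired with `λ = δ_v` is the DIVERGENCE form: `Σ_μ (Π(μ,ν)(v − e_μ, y, z) − Π(μ,ν)(v, y, z)) = 0`.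
[cite: Balaban1988Convergent, p.282 ("the identity (I.4.15) again"); Balaban1987RG1, (4.15) p.284, (5.9) p.293] -/
theorem ward_divergence_of_paired {ν : Fin d} {y z : Pt d}
    (hWX : ∀ lam : Pt d → ℝ, (Function.support lam).Finite → ∑' x, ∑ μ, P3 μ ν x y z * grad lam μ x = 0)
    (v : Pt d) : ∑ μ, (P3 μ ν (v - unitVec μ) y z - P3 μ ν v y z) = 0 := by
  classical
  -- the indicator gauge function of the point `v`
  set lam : Pt d → ℝ := fun x => if x = v then 1 else 0 with hlam
  have hfin : (Function.support lam).Finite := by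
    refine (Set.finite_singleton v).subset ?_
    intro x hx
    rw [Function.mem_support] at hx
    rw [Set.mem_singleton_iff]
    by_contra hxv
    exact hx (by simp [hlam, hxv])
  have h := hWX lam hfin
  -- the paired summand, termwise: `Π(μ,ν)(x,y,z)·(λ(x+e_μ) − λ(x))` is supported on `{v − e_μ, v}`
  have hterm : ∀ μ, (fun x => P3 μ ν x y z * grad lam μ x) = fun x =>
      (if x = v - unitVec μ then P3 μ ν (v - unitVec μ) y z else 0) - (if x = v then P3 μ ν v y z else 0) := by
    intro μ
    funext x
    simp only [grad, hlam]
    by_cases h1 : x = v - unitVec μ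
    · have h2 : x ≠ v := by
        rw [h1]
        intro h3
        have h4 := congrFun h3 μ
        simp [unitVec] at h4
      subst h1
      simp [h2]
    · have h3 : x + unitVec μ ≠ v := fun h4 => h1 (by rw [← h4, add_sub_cancel_right])
      by_cases h2 : x = v
      · subst h2
        simp [h3, h1]
      · simp [h1, h2, h3]
  have hsA : ∀ μ, Summable fun x : Pt d => if x = v - unitVec μ then P3 μ ν (v - unitVec μ) y z else 0 :=
    fun μ => (hasSum_ite_eq _ _).summable
  have hsB : ∀ μ, Summable fun x : Pt d => if x = v then P3 μ ν v y z else 0 :=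
    fun μ => (hasSum_ite_eq _ _).summable
  have hsum : ∀ μ, Summable fun x => P3 μ ν x y z * grad lam μ x := by
    intro μ
    rw [hterm μ]
    exact (hsA μ).sub (hsB μ)
  rw [Summable.tsum_finsetSum (fun μ _ => hsum μ)] at h
  rw [← h]
  refine Finset.sum_congr rfl fun μ _ => ?_
  rw [hterm μ, Summable.tsum_sub (hsA μ) (hsB μ), tsum_ite_eq, tsum_ite_eq]

/-- **[I] (5.9)₁/(5.15) for the (3.63)-summed kernel**: `Σ_μ (Π_{μν}(v − e_μ) − Π_{μν}(v)) = 0`, from the `x`-slot kernel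
Ward identity (I.4.15)₁ at `y = 0` for every `z` (paired form, as delivered by `Eq362KernelWard.wardX_threeKernel`),
summed over `z` (Fubini from `Decay3`). [cite: Balaban1988Convergent, (3.63) p.282; Balaban1987RG1, (5.9)/(5.15) p.293] -/
theorem wardFirst_sumKernel (hD : Decay3 P3 C κ) (hκ : 0 < κ)
    (hWX : ∀ (z : Pt d) (ν : Fin d) (y : Pt d) (lam : Pt d → ℝ), (Function.support lam).Finite →
      ∑' x, ∑ μ, P3 μ ν x y z * grad lam μ x = 0) :
    WardFirst (sumKernel P3) := by
  intro ν v
  have hz : ∀ z, ∑ μ, (P3 μ ν (v - unitVec μ) 0 z - P3 μ ν v 0 z) = 0 :=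
    fun z => ward_divergence_of_paired (fun lam hlam => hWX z ν 0 lam hlam) v
  have hs : ∀ μ (x : Pt d), Summable fun z : Pt d => P3 μ ν x 0 z := fun μ x => hD.summable_fibre_z hκ μ ν x
  calc ∑ μ, (sumKernel P3 μ ν (v - unitVec μ) - sumKernel P3 μ ν v)
      = ∑ μ, ∑' z, (P3 μ ν (v - unitVec μ) 0 z - P3 μ ν v 0 z) := by
        refine Finset.sum_congr rfl fun μ _ => ?_
        rw [sumKernel_apply, sumKernel_apply, ← Summable.tsum_sub (hs μ _) (hs μ _)]
    _ = ∑' z, ∑ μ, (P3 μ ν (v - unitVec μ) 0 z - P3 μ ν v 0 z) :=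
        (Summable.tsum_finsetSum (fun μ _ => (hs μ _).sub (hs μ _))).symm
    _ = 0 := by simp [hz]

/-- **[I] (5.16)/(5.36) with β = (5.42) FOR THE (3.63) KERNEL, DERIVED**: the second-order Taylor data of every component of
the summed kernel, with `β = Σ_v Π_{μ₀ν₀}(v)v_{μ₀}v_{ν₀}` (`μ₀ ≠ ν₀`), from the four inherited properties through [I] §5
(`B12Transverse536.taylorData3_of_symmetries`). [cite: Balaban1988Convergent, (3.64) p.283; Balaban1987RG1, (5.16) p.293, (5.36)–(5.37), (5.42) p.297] -/
theorem taylorData3_sumKernel (hT : TranslInv P3) (hD : Decay3 P3 C κ) (hκ : 0 < κ)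
    (hR : ∀ α μ ν x y z, P3 μ ν x y z = B14Sect3.axisSign α μ * B14Sect3.axisSign α ν
      * P3 μ ν (reflSrc α μ x) (reflSrc α ν y) (reflPt α z))
    (hP : ∀ (σ : Equiv.Perm (Fin d)) μ ν x y z, P3 μ ν x y z = P3 (σ μ) (σ ν) (permPt σ x) (permPt σ y) (permPt σ z))
    (hWX : ∀ (z : Pt d) (ν : Fin d) (y : Pt d) (lam : Pt d → ℝ), (Function.support lam).Finite →
      ∑' x, ∑ μ, P3 μ ν x y z * grad lam μ x = 0)
    {μ₀ ν₀ : Fin d} (h0 : μ₀ ≠ ν₀) (μ ν : Fin d) :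
    B12Rep537.TaylorData3 ((B12Beta.secondMoment (sumKernel P3) μ₀ ν₀ : ℝ) : ℂ) μ ν
      (B12Rep537.ofReal (sumKernel P3 μ ν)) :=
  taylorData3_of_symmetries (half_pos hκ) (decay510_sumKernel hD hκ) (permCovariant_sumKernel hP)
    (reflCovariant_sumKernel hT hR) (wardFirst_sumKernel hD hκ hWX) h0 μ ν

/-- **(3.64) `β′_j = β_j`, "This is the required equality", with [I]'s Taylor data DERIVED**: for a translation invariant,
decaying three-point kernel with the covariances (3.59) (coordinate permutations and axis reflections, every `z`) and the
kernel Ward identities (I.4.15)₁ (`x`-slot for every `z`, `y`-slot at `z = 0`),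
`β′_j = Σ_{x,y}Π_{22}(x, y, 0)x₁y₁ = Σ_v Π_{21}(v)v₂v₁ = β_j` — the right side being [I]'s DEFINITION (1.22) of the β-function
coefficient, *"Σ_x Π_{μν}(x)x_μx_ν for μ, ν arbitrary, μ ≠ ν"*, on the kernel (3.63) `Π_{μν}(v) = Σ_z Π_{μν}(v, 0, z)`.
`Eq362Marginals.eq364_of_WT` with its hypothesis `hTD` ((I.5.16)) DISCHARGED by `taylorData3_sumKernel`.
[cite: Balaban1988Convergent, (3.62)–(3.64) pp.282–283; Balaban1987RG1, (1.22) p.264] -/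
theorem eq364_of_symmetries (hT : TranslInv P3) (hD : Decay3 P3 C κ) (hκ : 0 < κ) {one two : Fin d} (h12 : two ≠ one)
    (hWT : ∀ (μ : Fin d) (x : Pt d) (lam : Pt d → ℝ), (Function.support lam).Finite →
      ∑' y : Pt d, ∑ ν, P3 μ ν x y 0 * grad lam ν y = 0)
    (hWX : ∀ (z : Pt d) (ν : Fin d) (y : Pt d) (lam : Pt d → ℝ), (Function.support lam).Finite →
      ∑' x, ∑ μ, P3 μ ν x y z * grad lam μ x = 0)
    (hR : ∀ α μ ν x y z, P3 μ ν x y z = B14Sect3.axisSign α μ * B14Sect3.axisSign α ν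
      * P3 μ ν (reflSrc α μ x) (reflSrc α ν y) (reflPt α z))
    (hP : ∀ (σ : Equiv.Perm (Fin d)) μ ν x y z, P3 μ ν x y z = P3 (σ μ) (σ ν) (permPt σ x) (permPt σ y) (permPt σ z)) :
    betaPrime P3 one two = B12Beta.secondMoment (sumKernel P3) two one :=
  Eq362Marginals.eq364_of_WT hT hD hκ h12 hWT (fun ν y lam hlam => hWX 0 ν y lam hlam)
    (fun μ ν => taylorData3_sumKernel hT hD hκ hR hP hWX h12 μ ν)

end Abstract

/-! ## §2. For the whole-lattice kernel of a pointed analytic localized family: (2.27) + (3.58) ⇒ (3.64) -/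

variable {M : ℕ} {g : ∀ X : Finset (Pt d), Pt d → (Fin d × ↥(sites M X) → ℂ) → ℂ}

/-- **[I]'s Taylor data (I.5.16)/(I.5.36) for the (3.63) kernel of a pointed analytic localized family, DERIVED** from the
per-domain data (2.27)(i)(ii)(iv), the linearized gauge invariance (2.27)(iii) and (3.58) for translations, axis reflections
and coordinate permutations. [cite: Balaban1988Convergent, (2.27) p.259, (3.58) p.282, (3.63) p.282; Balaban1987RG1, (5.16) p.293, (5.36) p.297] -/
theorem taylorData3_kernelPt (hM : 0 < M) {U : ∀ X : Finset (Pt d), Set (Fin d × ↥(sites M X) → ℂ)}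
    (hU : ∀ X, IsOpen (U X)) (hg : ∀ X z, AnalyticOnNhd ℂ (g X z) (U X)) {R E₀ κ : ℝ} (hR : 0 < R) (hE₀ : 0 ≤ E₀)
    (hRU : ∀ X, polydisc (fun _ => R) ⊆ U X)
    (hA : ∀ (X : LocDom d) (z : Pt d), ∀ s ∈ polydisc (fun _ : Fin d × ↥(sites M X.1) => R),
      ‖g X.1 z s‖ ≤ E₀ * Real.exp (-κ * treeLen X.1))
    (hκ : kappa₀ (4 * 2 ^ d) (2 * d) ≤ κ / 3) (hκ0 : 0 < κ)
    (hginv : ∀ (X : Finset (Pt d)) (z : Pt d) (lam : Pt d → ℝ), ∀ᶠ B in 𝓝 (0 : Fin d × ↥(sites M X) → ℂ),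
      ∀ᶠ t in 𝓝 (0 : ℂ), g X z (B + t • gaugeDir M X lam) = g X z B)
    (h358 : Eq358Transl M g R) (hrefl : Eq358Refl M g R) (hperm : Eq358Perm M g R)
    {μ₀ ν₀ : Fin d} (h0 : μ₀ ≠ ν₀) (μ ν : Fin d) :
    B12Rep537.TaylorData3 ((B12Beta.secondMoment (sumKernel (kernelPt M g)) μ₀ ν₀ : ℝ) : ℂ) μ ν
      (B12Rep537.ofReal (sumKernel (kernelPt M g) μ ν)) := by
  have hκ' : kappa₀ (4 * 2 ^ d) (2 * d) ≤ κ := hκ.trans (by linarith)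
  have h0U : ∀ X, (0 : Fin d × ↥(sites M X) → ℂ) ∈ U X := fun X => hRU X (zero_mem_polydisc fun _ => hR.le)
  have hE₂ : 0 ≤ 4 * E₀ / R ^ 2 := div_nonneg (mul_nonneg (by norm_num) hE₀) (pow_nonneg hR.le 2)
  have hloc : ∀ z X μ ν x y, kernelOf M (fun X => g X z) X μ ν x y ≠ 0 → coarse M x ∈ X ∧ coarse M y ∈ X :=
    fun z X μ ν x y h => kernelOf_loc hM X μ ν x y h
  have hbd : ∀ z, ∀ X : LocDom d, ∀ μ ν x y,
      |kernelOf M (fun X => g X z) X.1 μ ν x y| ≤ 4 * E₀ / R ^ 2 * Real.exp (-κ * treeLen X.1) :=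
    fun z => kernelOf_bound (g := fun X => g X z) hU (fun X => hg X z) hR hE₀ hRU (fun X s hs => hA X z s hs)
  have hT : TranslInv (kernelPt M g) := translInv_kernelPt hg hR hRU hA hκ' h358
  have hD : Decay3 (kernelPt M g) (4 * E₀ / R ^ 2 * K₀ (4 * 2 ^ d) (2 * d) * Real.exp (4 * κ / 3))
      (κ / (3 * d * M)) := fun μ ν x y z =>
    decay3_threeKernel hM hE₂ hκ hκ0.le (hloc z) (hbd z) μ ν x y z
  have hd : 0 < d := Fin.pos μ₀
  have hr : 0 < κ / (3 * d * M) := div_pos hκ0 (by positivity)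
  have hWX : ∀ (z : Pt d) (ν : Fin d) (y : Pt d) (lam : Pt d → ℝ), (Function.support lam).Finite →
      ∑' x : Pt d, ∑ μ, kernelPt M g μ ν x y z * grad lam μ x = 0 := fun z ν y lam hlam =>
    wardX_threeKernel hM hE₂ hκ hκ0.le (hloc z) (hbd z)
      (fun X ν' y' lam' _ => wardX_kernelOf hU h0U (fun X => hg X z) (fun X lam'' => hginv X z lam'') X.1 ν' y' lam')
      z ν y lam hlam
  have hRfl : ∀ α μ ν x y z, kernelPt M g μ ν x y z = B14Sect3.axisSign α μ * B14Sect3.axisSign α ν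
      * kernelPt M g μ ν (reflSrc α μ x) (reflSrc α ν y) (reflPt α z) :=
    fun α μ ν x y z => kernelPt_refl hg hR hRU hA hκ' hrefl α μ ν x y z
  have hPrm : ∀ (σ : Equiv.Perm (Fin d)) μ ν x y z,
      kernelPt M g μ ν x y z = kernelPt M g (σ μ) (σ ν) (permPt σ x) (permPt σ y) (permPt σ z) :=
    fun σ μ ν x y z => kernelPt_perm hg hR hRU hA hκ' hperm σ μ ν x y z
  exact taylorData3_sumKernel hT hD hr hRfl hPrm hWX h0 μ ν

/-- **(3.64) `β′_j = β_j` for the whole-lattice kernel of a pointed analytic localized family, on the inputs (2.27) + (3.58)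
ALONE** — `Eq358TranslInv.eq364_kernelPt` WITHOUT the Taylor-data hypothesis `hTD`: `β_j` is [I]'s (1.22)-moment
`Σ_v Π_{21}(v)v₂v₁` of the (3.63) kernel `Σ_z Π^{(j)}_{μν}(v, 0, z)`, and (I.5.16) for that kernel is the theorem
`taylorData3_kernelPt`.  Hypotheses, exactly: (2.27)(i)(ii)(iv) (`hU`, `hg`, `hR`, `hRU`, `hA`, `hκ`), (2.27)(iii) linearized
(`hginv`), (3.58) for translations / axis reflections / coordinate permutations (`h358`, `hrefl`, `hperm`).
[cite: Balaban1988Convergent, (3.64) p.283 ("This is the required equality"), (2.27) p.259, (3.58) p.282; Balaban1987RG1, (1.22) p.264] -/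
theorem eq364_kernelPt_of_symmetries (hM : 0 < M) {U : ∀ X : Finset (Pt d), Set (Fin d × ↥(sites M X) → ℂ)}
    (hU : ∀ X, IsOpen (U X)) (hg : ∀ X z, AnalyticOnNhd ℂ (g X z) (U X)) {R E₀ κ : ℝ} (hR : 0 < R) (hE₀ : 0 ≤ E₀)
    (hRU : ∀ X, polydisc (fun _ => R) ⊆ U X)
    (hA : ∀ (X : LocDom d) (z : Pt d), ∀ s ∈ polydisc (fun _ : Fin d × ↥(sites M X.1) => R),
      ‖g X.1 z s‖ ≤ E₀ * Real.exp (-κ * treeLen X.1))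
    (hκ : kappa₀ (4 * 2 ^ d) (2 * d) ≤ κ / 3) (hκ0 : 0 < κ)
    (hginv : ∀ (X : Finset (Pt d)) (z : Pt d) (lam : Pt d → ℝ), ∀ᶠ B in 𝓝 (0 : Fin d × ↥(sites M X) → ℂ),
      ∀ᶠ t in 𝓝 (0 : ℂ), g X z (B + t • gaugeDir M X lam) = g X z B)
    (h358 : Eq358Transl M g R) (hrefl : Eq358Refl M g R) (hperm : Eq358Perm M g R)
    {one two : Fin d} (h12 : two ≠ one) :
    betaPrime (kernelPt M g) one two = B12Beta.secondMoment (sumKernel (kernelPt M g)) two one :=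
  eq364_kernelPt hM (Fin.pos one) hU hg hR hE₀ hRU hA hκ hκ0 hginv h358 h12
    (taylorData3_kernelPt hM hU hg hR hE₀ hRU hA hκ hκ0 hginv h358 hrefl hperm h12)

end

end Literature.MathematicalPhysics.QuantumFieldTheory.Balaban1983to89.B14.Eq364Symmetries
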